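import Summits.Ventures.CertifiedQuantumChemistry.Barriers.DifferencePencilCeiling
import Summits.Ventures.CertifiedQuantumChemistry.Rows.ConjectureSU
import HarnessLib

/-!
# Barrier (structural, PROVED), part 2 of 3: the ADDITIVITY FLOOR of same-class difference pencils,
# VALUE FORM for the DQG sector programme — a `dE-direct:d` / `dE-direct:b` bracket certified by the
# DQG class always CONTAINS the difference `P_A − P_B` of the DQG values, so it cannot cancel relaxation
# error beyond the CONSISTENCY of the DQG gap across the pair (LADDER-CHEM §2 «door A»)

Part 2 of `Barriers/DifferencePencilCeiling.lean` (chem-type-10, X1 item (6), gen 3; part 1 = linearity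
§1 + pointwise §2; part 3 = `DifferencePencilCeilingT1T2p.lean`). Source typed (in-house, as printed):
chem-solver-4 `HOME/solver/diff/DESIGN.md` §1 (F2), sha16 5262a768ac94f1c1, verbatim: «(F2) additivity
floor: L_R(K⁺_μ) + L_R(F_B) ≤ L_R((1+μ)F_A) = (1+μ)L_R(F_A) (a min is superadditive, positively
homogeneous) ⇒ the pencil lower bound ≤ [L_R(A) − L_R(B)] − μW_A and the upper ≥ [L_R(A) − L_R(B)] +
νW_B ⇒ W(D) ≥ μW_A + νW_B, and the bracket always contains L_R(A) − L_R(B) (the naive difference of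
relaxed optima) as well as D». Here `R` = DQG (`IsDQGFeasibleSector a b`), `P_F := Model.pqgSectorEnergy
F a b` (spelling `abbrev` of `Rows/ConjectureSU.lean` for the Literature value `pqgSectorEnergy` at the
model's cast tables), `K⁺_μ = c·F_A − F_B` (`Model.lincomb c (-1) F_A F_B`, `c = 1 + μ`), and a DQG lower
certificate for a file `F` proves `ℓ ≤ Re E_F` on every DQG-feasible pair of the sector — literally the
binder `hlo` of the cell's `lowerRow_of_forall_isDQGFeasibleSector` — hence `ℓ ≤ P_F`.

HONEST FRAMING of the venture (verbatim): certified bounds for a stated model Hamiltonian in a stated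
basis; not a claim about the real molecule or material beyond that model. Nothing here is a number about
any file; it is a kernel-checked LIMITATION of one certificate class, with its doors.

## The theorems (all PROVED; 0 sorry; one `def : Prop` with its proof)

* `Model.pqgSectorEnergy_pencil_add_le` — **(F2) as printed**: `P(c·F_A − F_B) + P(F_B) ≤ c·P(F_A)` for
  `c > 0`, `a, b ≤ k` (no symmetry needed).
* `pencilLower_le_pqg` / `pencilLower_le_pqg_sub`: a DQG-certified pencil value `ℓ` and an upper row
  `u_A` (symmetric `F_A`, `c ≥ 1`) give **`ℓ − (c−1)·u_A ≤ (P_A − P_B) − (c−1)·(u_A − P_A) ≤ P_A − P_B`**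
  («the pencil lower bound ≤ [L_R(A) − L_R(B)] − μW_A»); `pencilLowerOfLower_le_pqg_sub` the `c ≤ 1`
  variant with a same-class lower value `l_A`; mirror `pencilUpper_ge_pqg` / `pqg_sub_le_pencilUpper`
  («the upper ≥ [L_R(A) − L_R(B)] + νW_B»).
* `pencilBracket_straddles_pqg` — **«the bracket always contains L_R(A) − L_R(B)»**;
  `pencilWidth_ge_pqg` — **«W(D) ≥ μW_A + νW_B»** (with `W_X := u_X − P_X`);
  `pencilWidth_ge_abs_gap_sub_gap` — the GAP-INCONSISTENCY FLOOR **`W ≥ |(E₀(A) − P_A) − (E₀(B) − P_B)|`**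
  (the bracket also contains `D`, chem-type-09's `diffBracket_of_pencils`): a same-class pencil cancels
  relaxation error only to the extent that the DQG gap `δ = E₀ − P` is the SAME on both files (cf. the
  venture barrier `PQGLowerBoundNotSizeConsistent`: DQG gaps drift with geometry / fragmentation);
  `pencilChain_two_le_pqg_sub` — a two-segment λ-grid chain (class (b)) telescopes to the SAME ceiling
  `P_A − P_B`: grid refinement buys the Rayleigh / curvature terms, never the additivity floor.
* `Barriers.PencilBracketContainsRelaxationDifference : Prop` and `…_holds` — the barrier as a statement.

## Measured companions (locators only; FLOAT / certified-P numbers of other seats, NOT used here)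

chem-solver-4 kit j257770 (56/56 certificates ALL_VERIFIED, 0.67 core-h) [meas]: on the N₂/STO-6G
pairs at DQG the ratio `κ = W(D)/(W_A + W_B)` = 1.556 (near pair 1.0977/1.2000 Å) · 1.567 (near2) ·
3.88 (P-1 1.2000/1.0000) · 55 (far 2.0000/1.0977) — «LAW: pencil loss per side = min_μ[μ·W + X(μ)],
relaxation errors add linearly under lincomb (superadditivity tight to 1.5 mE_h)»; kit j258422 [meas]
δ-law `κ = 0.250 / 0.379 / 0.683` at `δ = 0.02 / 0.03 / 0.05 Å` (the near-degenerate regime where the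
μ-terms are small and the gaps agree); DQGT1 near pair κ = 1.844 (j258197) [meas]; chem-solver-6 kit
j260074 [meas] λ-grid `κ_b(n=2) = 1.372`, `κ_b(n=4) = 1.281` («the grid buys the chord |E″| and nothing
of the μ·W floor»). LADDER-CHEM.md v1.7 (ladder-directors, sha16 92c14044cd99a4cb at v1.10) §2:
«I-DIFF: its SDP-pencil form FAILED STEP-0 at DQG (κ 1.56–55, law: relaxation errors add linearly) ⇒
R2 now runs through door C».

## What this barrier does NOT say, and its doors

It does not say a pencil cannot beat `dE-from-absolutes` (it can and did: δ-pairs, κ = 0.25); it says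
the pencil bracket of ONE relaxation class has width `≥ |δ_A − δ_B| + (c−1)(u_A − P_A) + (c′−1)(u_B −
P_B)` — a NEAR-CONSISTENT-PAIR instrument. Doors (certificate shapes outside the hypothesis «ℓ is a value
certified on a FIXED feasible set for the file K alone»): (M1) Temple / Kato–Temple lower bounds with a
certified `β ≤ E₁` (state-dependent, not a relaxation value; tree `TempleKato.*`, `Rows/CISecondMoment`,
chem-type-09 / chem-solver-6 `GapCertificate`); (:s) sector-difference transfer-window certificates on
ONE file (chem-solver-5 DESIGN); (C) tightening the class itself on both files so that `δ_A`, `δ_B` are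
both `≤ θ`; pair-coupled relaxations (constraints across `A` and `B`: subsystem / shared-multiplier
programmes, `Rows/SubsystemSectorRows`, chem-idea-2 door M3) are outside this file but inside part 1's
pointwise §2 whenever their certificate still implies `ℓ ≤ Re E_K(x)` at the relevant pair.

References (tree, REUSED): part 1; chem-type-09 `Rows/DifferencePencilRows.lean` (`diffBracket_of_pencils`,
`Model.lincomb_isSymmetric`); `Rows/ConjectureSU.lean` (`Model.pqgSectorEnergy`); Literature
`RelaxationEnergyHierarchy` (`pqgSectorEnergy_le_rdmEnergy`, `le_pqgSectorEnergy_iff`,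
`pqgSectorEnergy_le_sectorGroundEnergy`), `VariationalRDMRelaxation`
(`le_sectorGroundEnergy_of_forall_isDQGFeasibleSector`). Print context: M. Nakata et al., J. Chem. Phys.
128 (2008) 164113 §II.A–C; R. T. Rockafellar, *Convex Analysis* (1970) Thm 5.5.
-/

noncomputable section

namespace Summit.Ventures.CertifiedQuantumChemistry

open Matrix Finset
open Literature.MathematicalPhysics.QuantumLattice Literature.MathematicalPhysics.QuantumChemistry
open scoped ComplexOrder

/-! ## §3 (numbering continues part 1) Value form for the DQG sector programme: the bracket contains `P_A − P_B`

`P_F := Model.pqgSectorEnergy F a b` (spelling `abbrev` of `Rows/ConjectureSU.lean` for the Literature value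
`pqgSectorEnergy` at the model's cast tables) is the optimal value of the cell's DQG sector programme on the
file `F`; a DQG lower certificate for `F` proves `ℓ ≤ Re E_F` on every DQG-feasible pair of the sector, i.e.
`ℓ ≤ P_F` (`le_pqgSectorEnergy_iff`). -/

section DQG

variable {k : ℕ}

/-- The DQG sector value lies below the exact sector energy of a symmetric model on its physical range
(`pqgSectorEnergy_le_sectorGroundEnergy` in the `Model` spelling): `P_F ≤ E₀(F; a, b)`. -/
theorem Model.pqgSectorEnergy_le_energy {F : Model k} (hF : F.IsSymmetric) {a b : ℕ} (ha : a ≤ k)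
    (hb : b ≤ k) : F.pqgSectorEnergy a b ≤ F.energy a b :=
  pqgSectorEnergy_le_sectorGroundEnergy (Model.hamiltonian_isHermitian hF) (by simpa using ha)
    (by simpa using hb)

/-- An upper row dominates the DQG value: `UpperRow F a b u ⇒ P_F ≤ u`. -/
theorem UpperRow.pqgSectorEnergy_le {F : Model k} (hF : F.IsSymmetric) {a b : ℕ} {u : ℚ}
    (hU : UpperRow F a b u) : F.pqgSectorEnergy a b ≤ ((u : ℚ) : ℝ) :=
  (Model.pqgSectorEnergy_le_energy hF hU.1 hU.2.1).trans hU.le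

/-- A value certified by the DQG class is below the DQG value: `(∀ DQG-feasible x, ℓ ≤ Re E_F(x)) ⇒ ℓ ≤ P_F`
on the physical range (`le_pqgSectorEnergy_iff`, `Model` spelling). -/
theorem Model.le_pqgSectorEnergy_of_forall (F : Model k) {a b : ℕ} (ha : a ≤ k) (hb : b ≤ k) {x : ℝ}
    (hx : ∀ γ Γ, IsDQGFeasibleSector a b γ Γ → x ≤
      (rdmEnergy (fun p q => (F.h p q : ℂ)) (fun p q r s => (F.eri p q r s : ℂ)) (F.ecore : ℂ) γ Γ).re) :
    x ≤ F.pqgSectorEnergy a b :=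
  (le_pqgSectorEnergy_iff _ _ _ (by simpa using ha) (by simpa using hb)).2 hx

/-- **(F2) AS PRINTED — «L_R(K⁺_μ) + L_R(F_B) ≤ L_R((1+μ)F_A) = (1+μ)L_R(F_A) (a min is superadditive,
positively homogeneous)», DQG class**: for any two table files on one orbital space, a sector `a, b ≤ k`
and `c > 0`, `P(c·F_A − F_B) + P(F_B) ≤ c·P(F_A)`. Proof: at every DQG-feasible pair `x`,
`P(K) ≤ Re E_K(x) = c·Re E_A(x) − Re E_B(x)` (§1) and `P(F_B) ≤ Re E_B(x)`, so `(P(K) + P(F_B))/c` is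
below the functional of `F_A` on the feasible set, hence below its infimum. No symmetry needed. -/
theorem Model.pqgSectorEnergy_pencil_add_le (FA FB : Model k) {a b : ℕ} (ha : a ≤ k) (hb : b ≤ k)
    {c : ℚ} (hc : 0 < c) :
    (Model.lincomb c (-1) FA FB).pqgSectorEnergy a b + FB.pqgSectorEnergy a b ≤
      (c : ℝ) * FA.pqgSectorEnergy a b := by
  have hc0 : (0 : ℝ) < (c : ℝ) := by exact_mod_cast hc
  have hkey : ((Model.lincomb c (-1) FA FB).pqgSectorEnergy a b + FB.pqgSectorEnergy a b) / (c : ℝ) ≤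
      FA.pqgSectorEnergy a b := by
    refine Model.le_pqgSectorEnergy_of_forall FA ha hb fun γ Γ hf => ?_
    have hK : (Model.lincomb c (-1) FA FB).pqgSectorEnergy a b ≤
        (rdmEnergy (fun p q => ((Model.lincomb c (-1) FA FB).h p q : ℂ))
          (fun p q r s => ((Model.lincomb c (-1) FA FB).eri p q r s : ℂ))
          ((Model.lincomb c (-1) FA FB).ecore : ℂ) γ Γ).re :=
      pqgSectorEnergy_le_rdmEnergy _ _ _ hf
    rw [Model.re_rdmEnergy_pencil] at hK
    have hB : FB.pqgSectorEnergy a b ≤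
        (rdmEnergy (fun p q => (FB.h p q : ℂ)) (fun p q r s => (FB.eri p q r s : ℂ))
          (FB.ecore : ℂ) γ Γ).re :=
      pqgSectorEnergy_le_rdmEnergy _ _ _ hf
    rw [div_le_iff₀ hc0]
    linarith
  have h := (div_le_iff₀ hc0).1 hkey
  linarith

/-- **THE ADDITIVITY FLOOR, VALUE FORM (DQG).** For table files `F_A, F_B` on one orbital space, one
sector `a, b ≤ k`, a multiplier `c > 0`, a pencil value `ℓ` CERTIFIED BY THE DQG CLASS for the file
`K = c·F_A − F_B` (the binder `hlo` of the cell's `lowerRow_of_forall_isDQGFeasibleSector`: `ℓ ≤ Re E_K`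
on every DQG-feasible pair of the sector) and any rational `u_A`:
`ℓ − (c−1)·u_A ≤ (P_A − P_B) − (c−1)·(u_A − P_A)` — (F2) plus `ℓ ≤ P(K)`. -/
theorem pencilLower_le_pqg (FA FB : Model k) {a b : ℕ} (ha : a ≤ k) (hb : b ≤ k) {c : ℚ}
    (hc : 0 < c) (ℓ uA : ℚ)
    (hℓ : ∀ γ Γ, IsDQGFeasibleSector a b γ Γ → ((ℓ : ℚ) : ℝ) ≤
      (rdmEnergy (fun p q => ((Model.lincomb c (-1) FA FB).h p q : ℂ))
        (fun p q r s => ((Model.lincomb c (-1) FA FB).eri p q r s : ℂ))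
        ((Model.lincomb c (-1) FA FB).ecore : ℂ) γ Γ).re) :
    ((ℓ - (c - 1) * uA : ℚ) : ℝ) ≤
      (FA.pqgSectorEnergy a b - FB.pqgSectorEnergy a b) -
        ((c : ℝ) - 1) * ((uA : ℝ) - FA.pqgSectorEnergy a b) := by
  have hF2 := Model.pqgSectorEnergy_pencil_add_le FA FB ha hb hc
  have hℓK : ((ℓ : ℚ) : ℝ) ≤ (Model.lincomb c (-1) FA FB).pqgSectorEnergy a b :=
    Model.le_pqgSectorEnergy_of_forall _ ha hb hℓ
  push_cast
  linarith

/-- **CEILING `P_A − P_B` (window multiplier `c ≥ 1`)**: with, in addition, an upper row `u_A` of a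
symmetric `F_A` (so that `P_A ≤ E₀(A) ≤ u_A`), the certified `dE-direct:d` lower leg never exceeds the
difference of the DQG VALUES of the two files: `ℓ − (c−1)·u_A ≤ P_A − P_B` (DESIGN.md (F2): «the pencil
lower bound ≤ [L_R(A) − L_R(B)] − μW_A»). -/
theorem pencilLower_le_pqg_sub {FA : Model k} (FB : Model k) (hA : FA.IsSymmetric) {a b : ℕ}
    {c : ℚ} (hc : 1 ≤ c) (ℓ : ℚ) {uA : ℚ}
    (hℓ : ∀ γ Γ, IsDQGFeasibleSector a b γ Γ → ((ℓ : ℚ) : ℝ) ≤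
      (rdmEnergy (fun p q => ((Model.lincomb c (-1) FA FB).h p q : ℂ))
        (fun p q r s => ((Model.lincomb c (-1) FA FB).eri p q r s : ℂ))
        ((Model.lincomb c (-1) FA FB).ecore : ℂ) γ Γ).re)
    (hU : UpperRow FA a b uA) :
    ((ℓ - (c - 1) * uA : ℚ) : ℝ) ≤ FA.pqgSectorEnergy a b - FB.pqgSectorEnergy a b := by
  have h := pencilLower_le_pqg FA FB hU.1 hU.2.1 (lt_of_lt_of_le zero_lt_one hc) ℓ uA hℓ
  have hc' : (0 : ℝ) ≤ (c : ℝ) - 1 := by exact_mod_cast sub_nonneg.2 hc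
  have hu' : (0 : ℝ) ≤ ((uA : ℚ) : ℝ) - FA.pqgSectorEnergy a b :=
    sub_nonneg.2 (hU.pqgSectorEnergy_le hA)
  have hprod := mul_nonneg hc' hu'
  linarith

/-- **CEILING `P_A − P_B`, multiplier `c ≤ 1` (the variant `diffLowerRow_of_pencil_of_lowerRow`,
`ΔE_L = ℓ + (1 − c)·l_A`)** — provided the absolute LOWER value `l_A` is itself certified by the SAME
class (`l_A ≤ Re E_A` on every DQG-feasible pair, hence `l_A ≤ P_A`): `ℓ + (1−c)·l_A ≤ P_A − P_B` for
`0 < c ≤ 1`. With an `l_A` from a TIGHTER class the leg may exceed `P_A − P_B` by `(1−c)·(l_A − P_A)` —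
that is door (C) (tighten the class), not an escape inside the class. -/
theorem pencilLowerOfLower_le_pqg_sub (FA FB : Model k) {a b : ℕ} (ha : a ≤ k) (hb : b ≤ k) {c : ℚ}
    (hc0 : 0 < c) (hc1 : c ≤ 1) (ℓ lA : ℚ)
    (hℓ : ∀ γ Γ, IsDQGFeasibleSector a b γ Γ → ((ℓ : ℚ) : ℝ) ≤
      (rdmEnergy (fun p q => ((Model.lincomb c (-1) FA FB).h p q : ℂ))
        (fun p q r s => ((Model.lincomb c (-1) FA FB).eri p q r s : ℂ))
        ((Model.lincomb c (-1) FA FB).ecore : ℂ) γ Γ).re)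
    (hl : ∀ γ Γ, IsDQGFeasibleSector a b γ Γ → ((lA : ℚ) : ℝ) ≤
      (rdmEnergy (fun p q => (FA.h p q : ℂ)) (fun p q r s => (FA.eri p q r s : ℂ))
        (FA.ecore : ℂ) γ Γ).re) :
    ((ℓ + (1 - c) * lA : ℚ) : ℝ) ≤ FA.pqgSectorEnergy a b - FB.pqgSectorEnergy a b := by
  have hF2 := Model.pqgSectorEnergy_pencil_add_le FA FB ha hb hc0
  have hℓK : ((ℓ : ℚ) : ℝ) ≤ (Model.lincomb c (-1) FA FB).pqgSectorEnergy a b :=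
    Model.le_pqgSectorEnergy_of_forall _ ha hb hℓ
  have hlA : ((lA : ℚ) : ℝ) ≤ FA.pqgSectorEnergy a b := Model.le_pqgSectorEnergy_of_forall _ ha hb hl
  have h1c : (0 : ℝ) ≤ 1 - (c : ℝ) := by exact_mod_cast sub_nonneg.2 hc1
  have hprod := mul_le_mul_of_nonneg_left hlA h1c
  push_cast
  linarith

/-- **THE ADDITIVITY FLOOR, UPPER SIDE (DQG).** For the reversed pencil `K′ = c′·F_B − F_A` (`c′ > 0`)
with a DQG-certified value `ℓ′` and any rational `u_B`:
`(P_A − P_B) + (c′−1)·(u_B − P_B) ≤ (c′−1)·u_B − ℓ′`. -/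
theorem pencilUpper_ge_pqg (FA FB : Model k) {a b : ℕ} (ha : a ≤ k) (hb : b ≤ k) {c' : ℚ}
    (hc : 0 < c') (ℓ' uB : ℚ)
    (hℓ' : ∀ γ Γ, IsDQGFeasibleSector a b γ Γ → ((ℓ' : ℚ) : ℝ) ≤
      (rdmEnergy (fun p q => ((Model.lincomb c' (-1) FB FA).h p q : ℂ))
        (fun p q r s => ((Model.lincomb c' (-1) FB FA).eri p q r s : ℂ))
        ((Model.lincomb c' (-1) FB FA).ecore : ℂ) γ Γ).re) :
    (FA.pqgSectorEnergy a b - FB.pqgSectorEnergy a b) +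
        ((c' : ℝ) - 1) * ((uB : ℝ) - FB.pqgSectorEnergy a b) ≤
      (((c' - 1) * uB - ℓ' : ℚ) : ℝ) := by
  have h := pencilLower_le_pqg FB FA ha hb hc ℓ' uB hℓ'
  push_cast at h ⊢
  linarith

/-- **FLOOR `P_A − P_B` of the upper leg (`c′ ≥ 1`)**: with an upper row `u_B` of a symmetric `F_B`,
`P_A − P_B ≤ (c′−1)·u_B − ℓ′` (DESIGN.md (F2): «the upper ≥ [L_R(A) − L_R(B)] + νW_B»). -/
theorem pqg_sub_le_pencilUpper (FA : Model k) {FB : Model k} (hB : FB.IsSymmetric) {a b : ℕ}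
    {c' : ℚ} (hc : 1 ≤ c') (ℓ' : ℚ) {uB : ℚ}
    (hℓ' : ∀ γ Γ, IsDQGFeasibleSector a b γ Γ → ((ℓ' : ℚ) : ℝ) ≤
      (rdmEnergy (fun p q => ((Model.lincomb c' (-1) FB FA).h p q : ℂ))
        (fun p q r s => ((Model.lincomb c' (-1) FB FA).eri p q r s : ℂ))
        ((Model.lincomb c' (-1) FB FA).ecore : ℂ) γ Γ).re)
    (hU : UpperRow FB a b uB) :
    FA.pqgSectorEnergy a b - FB.pqgSectorEnergy a b ≤ (((c' - 1) * uB - ℓ' : ℚ) : ℝ) := by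
  have h := pencilUpper_ge_pqg FA FB hU.1 hU.2.1 (lt_of_lt_of_le zero_lt_one hc) ℓ' uB hℓ'
  have hc' : (0 : ℝ) ≤ (c' : ℝ) - 1 := by exact_mod_cast sub_nonneg.2 hc
  have hu' : (0 : ℝ) ≤ ((uB : ℚ) : ℝ) - FB.pqgSectorEnergy a b :=
    sub_nonneg.2 (hU.pqgSectorEnergy_le hB)
  have hprod := mul_nonneg hc' hu'
  linarith

/-- **«THE BRACKET ALWAYS CONTAINS `L_R(A) − L_R(B)`» (DESIGN.md (F2), DQG class).** Both legs of a
two-sided `dE-direct:d` bracket certified by the DQG class straddle the difference of the DQG values: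
`ℓ − (c−1)·u_A ≤ P_A − P_B ≤ (c′−1)·u_B − ℓ′`. The same hypotheses give the certified bracket on
`D = E₀(A) − E₀(B)` (`diffBracket_of_pencils`, chem-type-09), so the bracket contains BOTH numbers. -/
theorem pencilBracket_straddles_pqg {FA FB : Model k} (hA : FA.IsSymmetric) (hB : FB.IsSymmetric)
    {a b : ℕ} {c c' : ℚ} (hc : 1 ≤ c) (hc' : 1 ≤ c') (ℓ ℓ' : ℚ) {uA uB : ℚ}
    (hℓ : ∀ γ Γ, IsDQGFeasibleSector a b γ Γ → ((ℓ : ℚ) : ℝ) ≤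
      (rdmEnergy (fun p q => ((Model.lincomb c (-1) FA FB).h p q : ℂ))
        (fun p q r s => ((Model.lincomb c (-1) FA FB).eri p q r s : ℂ))
        ((Model.lincomb c (-1) FA FB).ecore : ℂ) γ Γ).re)
    (hUA : UpperRow FA a b uA)
    (hℓ' : ∀ γ Γ, IsDQGFeasibleSector a b γ Γ → ((ℓ' : ℚ) : ℝ) ≤
      (rdmEnergy (fun p q => ((Model.lincomb c' (-1) FB FA).h p q : ℂ))
        (fun p q r s => ((Model.lincomb c' (-1) FB FA).eri p q r s : ℂ))
        ((Model.lincomb c' (-1) FB FA).ecore : ℂ) γ Γ).re)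
    (hUB : UpperRow FB a b uB) :
    ((ℓ - (c - 1) * uA : ℚ) : ℝ) ≤ FA.pqgSectorEnergy a b - FB.pqgSectorEnergy a b ∧
      FA.pqgSectorEnergy a b - FB.pqgSectorEnergy a b ≤ (((c' - 1) * uB - ℓ' : ℚ) : ℝ) :=
  ⟨pencilLower_le_pqg_sub FB hA hc ℓ hℓ hUA, pqg_sub_le_pencilUpper FA hB hc' ℓ' hℓ' hUB⟩

/-- **WIDTH FLOOR «`W(D) ≥ μW_A + νW_B`» (DESIGN.md (F2), DQG class, with `u_X − P_X` the window
slack of each file, `c, c′ > 0`)**: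
`[(c′−1)·u_B − ℓ′] − [ℓ − (c−1)·u_A] ≥ (c−1)(u_A − P_A) + (c′−1)(u_B − P_B)`. -/
theorem pencilWidth_ge_pqg (FA FB : Model k) {a b : ℕ} (ha : a ≤ k) (hb : b ≤ k) {c c' : ℚ}
    (hc : 0 < c) (hc' : 0 < c') (ℓ ℓ' uA uB : ℚ)
    (hℓ : ∀ γ Γ, IsDQGFeasibleSector a b γ Γ → ((ℓ : ℚ) : ℝ) ≤
      (rdmEnergy (fun p q => ((Model.lincomb c (-1) FA FB).h p q : ℂ))
        (fun p q r s => ((Model.lincomb c (-1) FA FB).eri p q r s : ℂ))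
        ((Model.lincomb c (-1) FA FB).ecore : ℂ) γ Γ).re)
    (hℓ' : ∀ γ Γ, IsDQGFeasibleSector a b γ Γ → ((ℓ' : ℚ) : ℝ) ≤
      (rdmEnergy (fun p q => ((Model.lincomb c' (-1) FB FA).h p q : ℂ))
        (fun p q r s => ((Model.lincomb c' (-1) FB FA).eri p q r s : ℂ))
        ((Model.lincomb c' (-1) FB FA).ecore : ℂ) γ Γ).re) :
    ((c : ℝ) - 1) * ((uA : ℝ) - FA.pqgSectorEnergy a b) +
        ((c' : ℝ) - 1) * ((uB : ℝ) - FB.pqgSectorEnergy a b) ≤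
      (((c' - 1) * uB - ℓ' : ℚ) : ℝ) - ((ℓ - (c - 1) * uA : ℚ) : ℝ) := by
  have h1 := pencilLower_le_pqg FA FB ha hb hc ℓ uA hℓ
  have h2 := pencilUpper_ge_pqg FA FB ha hb hc' ℓ' uB hℓ'
  linarith

/-- **THE GAP-INCONSISTENCY FLOOR.** The DQG-certified two-sided pencil bracket contains both
`D = E₀(A) − E₀(B)` (soundness, `diffBracket_of_pencils`) and `P_A − P_B` (this file), hence its width is
at least their distance — the difference of the two files' DQG relaxation gaps `δ_X = E₀(X) − P_X`:
`[(c′−1)·u_B − ℓ′] − [ℓ − (c−1)·u_A] ≥ |(E₀(A) − P_A) − (E₀(B) − P_B)|` (DESIGN.md (F2): «the bracket always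
contains L_R(A) − L_R(B) … as well as D ⇒ W(D) ≥ |W_A − W_B|», there with exact uppers). A same-class
pencil cancels relaxation error only to the extent that the gap is CONSISTENT across the pair (cf. the
venture barrier `PQGLowerBoundNotSizeConsistent`: DQG gaps drift with geometry / fragmentation). -/
theorem pencilWidth_ge_abs_gap_sub_gap {FA FB : Model k} (hA : FA.IsSymmetric) (hB : FB.IsSymmetric)
    {a b : ℕ} {c c' : ℚ} (hc : 1 ≤ c) (hc' : 1 ≤ c') (ℓ ℓ' : ℚ) {uA uB : ℚ}
    (hℓ : ∀ γ Γ, IsDQGFeasibleSector a b γ Γ → ((ℓ : ℚ) : ℝ) ≤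
      (rdmEnergy (fun p q => ((Model.lincomb c (-1) FA FB).h p q : ℂ))
        (fun p q r s => ((Model.lincomb c (-1) FA FB).eri p q r s : ℂ))
        ((Model.lincomb c (-1) FA FB).ecore : ℂ) γ Γ).re)
    (hUA : UpperRow FA a b uA)
    (hℓ' : ∀ γ Γ, IsDQGFeasibleSector a b γ Γ → ((ℓ' : ℚ) : ℝ) ≤
      (rdmEnergy (fun p q => ((Model.lincomb c' (-1) FB FA).h p q : ℂ))
        (fun p q r s => ((Model.lincomb c' (-1) FB FA).eri p q r s : ℂ))
        ((Model.lincomb c' (-1) FB FA).ecore : ℂ) γ Γ).re)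
    (hUB : UpperRow FB a b uB) :
    |(FA.energy a b - FA.pqgSectorEnergy a b) - (FB.energy a b - FB.pqgSectorEnergy a b)| ≤
      (((c' - 1) * uB - ℓ' : ℚ) : ℝ) - ((ℓ - (c - 1) * uA : ℚ) : ℝ) := by
  have ha : a ≤ k := hUA.1
  have hb : b ≤ k := hUA.2.1
  -- the bracket contains P_A − P_B …
  obtain ⟨hP1, hP2⟩ := pencilBracket_straddles_pqg hA hB hc hc' ℓ ℓ' hℓ hUA hℓ' hUB
  -- … and D = E₀(A) − E₀(B) (chem-type-09's soundness, through the DQG lower rows of K and K′,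
  -- `le_sectorGroundEnergy_of_forall_isDQGFeasibleSector` = the body of the cell's
  -- `lowerRow_of_forall_isDQGFeasibleSector`)
  have hK : LowerRow (Model.lincomb c (-1) FA FB) a b ℓ :=
    ⟨ha, hb, le_sectorGroundEnergy_of_forall_isDQGFeasibleSector
      (Model.hamiltonian_isHermitian (Model.lincomb_isSymmetric hA hB)) (by simpa using ha)
      (by simpa using hb) hℓ⟩
  have hK' : LowerRow (Model.lincomb c' (-1) FB FA) a b ℓ' :=
    ⟨ha, hb, le_sectorGroundEnergy_of_forall_isDQGFeasibleSector
      (Model.hamiltonian_isHermitian (Model.lincomb_isSymmetric hB hA)) (by simpa using ha)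
      (by simpa using hb) hℓ'⟩
  obtain ⟨hD1, hD2⟩ := diffBracket_of_pencils hA hB hc hc' hK hUA hK' hUB
  have hD1' := hD1.le
  have hD2' := hD2.le
  simp only [Model.energyDiff] at hD1' hD2'
  rw [abs_le]
  constructor <;> linarith

/-- **GRID REFINEMENT DOES NOT LIFT THE CEILING (class (b), two segments).** Chaining two DQG-certified
pencil lower legs through an intermediate file `M` on the same orbital space (a λ-grid point
`M = Model.lincomb (1−s) s F_B F_A`, or any symmetric file at all) — leg₁ for the pair `(F_A, M)`, leg₂ for
`(M, F_B)`, summed as in `DiffLowerRow.trans` — is bounded by the TELESCOPED ceiling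
`(P_A − P_M) + (P_M − P_B) = P_A − P_B`. (chem-solver-6 kit j260074 [meas]: «the grid buys the chord |E″|
and nothing of the μ·W floor».) -/
theorem pencilChain_two_le_pqg_sub {FA M FB : Model k} (hA : FA.IsSymmetric) (hM : M.IsSymmetric)
    {a b : ℕ} {c₁ c₂ : ℚ} (hc₁ : 1 ≤ c₁) (hc₂ : 1 ≤ c₂) (ℓ₁ ℓ₂ : ℚ) {uA uM : ℚ}
    (hℓ₁ : ∀ γ Γ, IsDQGFeasibleSector a b γ Γ → ((ℓ₁ : ℚ) : ℝ) ≤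
      (rdmEnergy (fun p q => ((Model.lincomb c₁ (-1) FA M).h p q : ℂ))
        (fun p q r s => ((Model.lincomb c₁ (-1) FA M).eri p q r s : ℂ))
        ((Model.lincomb c₁ (-1) FA M).ecore : ℂ) γ Γ).re)
    (hUA : UpperRow FA a b uA)
    (hℓ₂ : ∀ γ Γ, IsDQGFeasibleSector a b γ Γ → ((ℓ₂ : ℚ) : ℝ) ≤
      (rdmEnergy (fun p q => ((Model.lincomb c₂ (-1) M FB).h p q : ℂ))
        (fun p q r s => ((Model.lincomb c₂ (-1) M FB).eri p q r s : ℂ))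
        ((Model.lincomb c₂ (-1) M FB).ecore : ℂ) γ Γ).re)
    (hUM : UpperRow M a b uM) :
    ((ℓ₁ - (c₁ - 1) * uA : ℚ) : ℝ) + ((ℓ₂ - (c₂ - 1) * uM : ℚ) : ℝ) ≤
      FA.pqgSectorEnergy a b - FB.pqgSectorEnergy a b := by
  have h1 := pencilLower_le_pqg_sub M hA hc₁ ℓ₁ hℓ₁ hUA
  have h2 := pencilLower_le_pqg_sub FB hM hc₂ ℓ₂ hℓ₂ hUM
  linarith

end DQG
/-! ## §4 The barrier as a `Prop` -/

namespace Barriers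

/-- **BARRIER «ADDITIVITY FLOOR OF SAME-CLASS DIFFERENCE PENCILS» (LADDER-CHEM §2 door A, DQG class;
chem-solver-4 DESIGN.md §1 (F2), verbatim: «the bracket always contains L_R(A) − L_R(B) (the naive
difference of relaxed optima) as well as D»).** For every pair of symmetric table files `F_A, F_B` on
one orbital space `Fin k`, every sector `(a, b)`, all multipliers `c, c′ ≥ 1`, every pencil value `ℓ`
certified by the DQG class for `c·F_A − F_B` and `ℓ′` for `c′·F_B − F_A`, and all upper rows
`u_A`, `u_B`: the two-sided `dE-direct:d` bracket `[ℓ − (c−1)·u_A, (c′−1)·u_B − ℓ′]` contains the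
difference `P_A − P_B` of the DQG VALUES (`Model.pqgSectorEnergy`). PROVED below
(`pencilBracketContainsRelaxationDifference_holds`); consequences in §3 (width ≥ window slacks;
width ≥ |δ_A − δ_B|; grid chains telescope to the same ceiling). Door: any certificate that is not a
value certified on a fixed feasible set of the pencil file (Temple-β, sector-transfer windows), or a
class tight on both files. -/
def PencilBracketContainsRelaxationDifference : Prop :=
  ∀ (k : ℕ) (FA FB : Model k), FA.IsSymmetric → FB.IsSymmetric →
    ∀ (a b : ℕ) (c c' ℓ ℓ' uA uB : ℚ), 1 ≤ c → 1 ≤ c' →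
      (∀ γ Γ, IsDQGFeasibleSector a b γ Γ → ((ℓ : ℚ) : ℝ) ≤
        (rdmEnergy (fun p q => ((Model.lincomb c (-1) FA FB).h p q : ℂ))
          (fun p q r s => ((Model.lincomb c (-1) FA FB).eri p q r s : ℂ))
          ((Model.lincomb c (-1) FA FB).ecore : ℂ) γ Γ).re) →
      UpperRow FA a b uA →
      (∀ γ Γ, IsDQGFeasibleSector a b γ Γ → ((ℓ' : ℚ) : ℝ) ≤
        (rdmEnergy (fun p q => ((Model.lincomb c' (-1) FB FA).h p q : ℂ))
          (fun p q r s => ((Model.lincomb c' (-1) FB FA).eri p q r s : ℂ))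
          ((Model.lincomb c' (-1) FB FA).ecore : ℂ) γ Γ).re) →
      UpperRow FB a b uB →
        ((ℓ - (c - 1) * uA : ℚ) : ℝ) ≤ FA.pqgSectorEnergy a b - FB.pqgSectorEnergy a b ∧
          FA.pqgSectorEnergy a b - FB.pqgSectorEnergy a b ≤ (((c' - 1) * uB - ℓ' : ℚ) : ℝ)

/-- **The barrier holds** (by `pencilBracket_straddles_pqg`). -/
theorem pencilBracketContainsRelaxationDifference_holds : PencilBracketContainsRelaxationDifference :=
  fun _k _FA _FB hA hB _a _b _c _c' ℓ ℓ' _uA _uB hc hc' hℓ hUA hℓ' hUB =>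
    pencilBracket_straddles_pqg hA hB hc hc' ℓ ℓ' hℓ hUA hℓ' hUB

end Barriers

end Summit.Ventures.CertifiedQuantumChemistry

end
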